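import Mathlib.Analysis.InnerProductSpace.PiL2
import Mathlib.LinearAlgebra.Matrix.ConjTranspose
import Mathlib.AlgebraicGeometry.Morphisms.Smooth
import Literature.AlgebraicGeometry.HodgeTheory.ClassesSupportedOn
import Literature.AlgebraicGeometry.HodgeTheory.RationalHodgeClasses
import Literature.NumberTheory.Transcendental.AnalytificationConnected
import HarnessLib

/-!
# The support of a special cycle on a ball quotient: Zariski closure of the image of a sub-ball

Family `hodge`, layer `Literature/AlgebraicGeometry/HodgeTheory`. Requested definition
(`defn-specialCycleSupport`, definition request (3) of route `HodgeConjecture/EisensteinMiddleThird`):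
"for a definite `𝓔`-sublattice `W ⊆ Λ` of rank `k`, the Zariski closure in `X` of `π(𝔹(W^⊥))`, as a
`Set X.left`, so that `classesSupportedOn X (specialCycleSupport … W) (2 * k)` types the special span".

## The mathematics

Kudla–Millson special cycles (Kudla–Millson 1990, §2; Bergeron–Millson–Moeglin (BMM), Part 2
§§3.1–3.3 of arXiv:1306.1515 = Acta Math. 216 (2016)): let `V` be a hermitian space of signature
`(n, 1)` over a CM field, `D = 𝔹ⁿ` the ball of negative lines of `V ⊗ ℂ`, `Γ` an arithmetic
lattice and `S = Γ \ 𝔹ⁿ`. "Recall that we can realize the symmetric space `X` as the set of negative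
`q`-planes in `V_{v₀}`. We then let `X_H` be the subset of `X` consisting of those `q`-planes which
lie in `U^⊥_{v₀}`" (`U ⊆ V` totally positive definite, `H = U(U^⊥)`), and "the natural map
`Γ_{g,U} z ↦ Γ_g z` yield[s] a (totally geodesic) immersion of `Γ_{g,U} \ X_H` into `Γ_g \ X`. We will
denote the corresponding (connected) cycle by `c(U, g, K)`" (BMM Part 2 §3.1, §3.3); `Z(U, g, K)` is
"the algebraic cycle" it carries (§3.2), of codimension `dim U` when `q = 1`. In Kudla–Millson's
notation `D_U = {Z ∈ D : Z ⊆ U^⊥}` and `C_U = Γ_U \ D_U → Γ \ D`.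

The route `EisensteinMiddleThird` presents its (NON-compact, finite-volume) ball quotients in a
chart: `X` is a smooth projective complex `n`-fold (`n = 4`), `A : HodgeModel n X` its
analytification, `Z ⊆ X` Zariski closed (the toroidal boundary), and
`π : EuclideanSpace ℂ (Fin n) → A.carrier` is holomorphic on the unit ball `𝔹ⁿ = {‖z‖ < 1}` and
restricts to a surjective covering `𝔹ⁿ → {x | (A.toComplexPoints x).pt ∉ Z}` whose deck relation is
`π z = π w ↔ ∃ γ ∈ S, w = γ · z`, the Möbius action of `Λ`-unitary matrices `γ`
(`γᴴ J γ = J`, `J = diag(1, -1, …, -1)`, Allcock–Freitag (2.1): the form `ā₀b₀ - ā₁b₁ - ⋯ - āₙbₙ`)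
in the affine chart `z₀ = 1` of `ℙⁿ(ℂ)`. In this chart the unit ball is exactly the set of
POSITIVE lines of `J` (`ballForm_ballLift_self`: `⟪ẑ, ẑ⟫_J = 1 - ‖z‖²` for `ẑ = (1, z)`), i.e. the
route's `(ℂ^{n+1}, J)` is BMM's `V_{v₀}` with the OPPOSITE sign (`-J` has signature `(n, 1)` and the
ball is its cone of negative lines); accordingly the sub-balls carrying special cycles are the
`𝔹(W^⊥)` for `W` NEGATIVE definite for `J` (= positive definite for `-J`, BMM's "totally positive"
`U`; e.g. the nodal and Eckardt root mirrors `r^⊥`, `⟪r, r⟫_J < 0`, of Allcock–Carlson–Toledo).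
Orthogonality being insensitive to the sign, nothing below depends on this choice.

## What this file defines (all `def`s with bodies; API proved)

* `ballGram n = J = Matrix.diagonal (1, -1, …, -1)` and `ballForm u v = star u ⬝ᵥ (J *ᵥ v)`, the
  hermitian form `ū₀ v₀ - Σᵢ ūᵢ vᵢ` of signature `(1, n)` (conjugate-linear in the first variable,
  as Mathlib's `Matrix.PosDef` and the tree's `ShimuraVarieties.hermForm (starRingEnd ℂ)`);
  `ballGram_four : ballGram 4 = Matrix.diagonal ![1, -1, -1, -1, -1]` is the route's matrix.
* `ballLift z = ẑ = (1, z₁, …, zₙ) : Fin (n + 1) → ℂ`, the homogeneous coordinates of the chart point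
  `z : EuclideanSpace ℂ (Fin n)` (`mulVec_ballLift`: `(γ ẑ)ᵢ = γᵢ₀ + Σⱼ γᵢ,ⱼ₊₁ zⱼ`, the sums in the
  route's deck relation; `smul_ballLift_eq_mulVec_iff`: that relation says `(γ ẑ)₀ • ŵ = γ ẑ`).
* `orthogonalSubBall W = 𝔹(W^⊥) = {z ∈ 𝔹ⁿ | ∀ w ∈ W, ⟪w, ẑ⟫_J = 0}` for ANY `W ⊆ ℂ^{n+1}` — an
  affine-linear slice of the ball (`mem_orthogonalSubBall_iff`: `Σⱼ w̄ⱼ₊₁ zⱼ = w̄₀`), Kudla–Millson's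
  `D_W`; it depends only on the span of `W` (`orthogonalSubBall_span`), is all of `𝔹ⁿ` for `W ⊆ {0}`
  and is EMPTY as soon as `W` contains a vector `w ≠ 0` with `⟪w, w⟫_J ≥ 0` (positive or isotropic),
  so only `J`-negative-definite `W` matter.
* `specialCycleSupport A π W : Set X.left` — **the Zariski closure in `X` of the set of (closed)
  points `(A.toComplexPoints (π z)).pt`, `z ∈ 𝔹(W^⊥)`**: the support of the special cycle
  `c(W) = Γ_W \ 𝔹(W^⊥) → Γ' \ 𝔹ⁿ ⊆ X(ℂ)` completed in `X`. For `W` spanned by a definite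
  `𝓔`-sublattice of rank `k` of an arithmetic `Λ`, `Γ'_W` is a lattice in `U(W^⊥)`, the image of
  `𝔹(W^⊥)` in `Γ' \ 𝔹ⁿ` is a closed analytic subvariety of dimension `n - k` (itself a ball quotient),
  algebraic by Borel's extension theorem / Baily–Borel, and its Zariski closure in the smooth
  compactification `X` is an irreducible `(n - k)`-fold (Chow); NONE of this is asserted here — the
  definition is the bare closure, and the codimension / algebraicity enter the route's items as
  hypotheses or cited facts. By construction `classesSupportedOn X (specialCycleSupport A π W) (2 * k)`
  (file `ClassesSupportedOn`) is the space of classes supported on the special cycle, and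
  `⨆_W classesSupportedOn …` over the rank-`k` definite sublattices types "the special span"
  exactly as `ShimuraVarieties.specialCycleClasses` does in the compact case (where the special
  subvariety is a datum field `UnitaryBallQuotientDatum.specialSubvariety`; here it is DEFINED).

* `specialCycleSpan A π L k : Submodule ℂ H²ᵏ(X(ℂ); ℂ)` — **the special span**
  `⨆_{W ⊆ L, dim span W = k} classesSupportedOn X (specialCycleSupport A π W) (2 * k)` relative to a set
  `L` of lattice vectors (the route's `𝓔^{n+1}`): the complexified definite-type part of
  `SC^{2k}(S)` (BMM Part 2 §3.5), typed in one word; only `J`-negative-definite spans contribute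
  (`classesSupportedOn_specialCycleSupport_eq_bot_of_nonneg`).

## API (all proved)

* `isClosed_specialCycleSupport`, `pt_mem_specialCycleSupport` (the images of `𝔹(W^⊥)` lie on it),
  `specialCycleSupport_minimal` (it is the smallest Zariski-closed set containing them),
  `specialCycleSupport_anti` (`W ⊆ W' ⇒ support W' ⊆ support W`), `specialCycleSupport_span`
  (generators suffice: a sublattice, its `ℤ`-basis and its complex span have the same support),
  `classesSupportedOn_specialCycleSupport_anti`; for the span: `classesSupportedOn_le_specialCycleSpan`
  (generators), `specialCycleSpan_le_iff` (bounding it), `specialCycleSpan_mono`,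
  `specialCycleSpan_le_of_forall_isClosed`.
* Non-vacuity — `specialCycleSupport_empty_eq_univ`: for `W = ∅` (whence for `W ⊆ {0}`) and `π`
  mapping the ball ONTO the complex points off a proper Zariski-closed `Z` (the route's covering
  clause), the support is all of `X` (`X` irreducible and Jacobson: closed points off `Z` are dense;
  SGA1 XII §2, the tree's `ComplexPoints.range_pt`); `…_of_isSmoothProjective` for the route's `X`.
* `Γ`-invariance — `specialCycleSupport_subset_of_deck`: under the route's deck clause
  (`π z = π w ↔ ∃ γ ∈ S, w = γ · z`) and `γᴴ J γ = J` on `S`, `support W ⊆ support (γ • W)` for every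
  `γ ∈ S`: `γ` carries `𝔹(W^⊥)` onto `𝔹((γW)^⊥)` (`ballForm_mulVec_mulVec`: `U(J)` preserves `⟪,⟫_J`)
  and `π` is constant on deck orbits — BMM Part 2 §3.3 / Kudla–Millson §2: `c(U)` depends only on
  the `Γ`-orbit of `U`.

## Design notes (junk analysis)

* `W` is a bare `Set (Fin (n + 1) → ℂ)`: an `𝓔`-sublattice, an `E`-subspace or a list of roots all
  coerce to it, and `orthogonalSubBall_span` shows the choice is immaterial. Rationality of `W`
  (needed for `c(W)` to be closed, of finite volume, algebraic) is NOT part of the definition: for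
  irrational `W` the image of `𝔹(W^⊥)` may be Zariski dense and the "support" is then all of `X` —
  junk, but well-typed, like `W ⊆ {0}`.
* The closure is taken in `X.left` (Zariski topology of the scheme), not in `X(ℂ)`: for the route's
  non-compact quotients the analytic image of `𝔹(W^⊥)` in `X(ℂ) ∖ Z(ℂ)` is closed there but not in
  `X(ℂ)`; its Zariski closure adds the boundary points of the cycle in the toroidal
  compactification, which is what "algebraic `(n - k)`-fold in `X`" refers to.
* Values of `π` off the ball never enter (`orthogonalSubBall ⊆ 𝔹ⁿ`).
* `n = 0`: `𝔹⁰ = {0}`, `ẑ = (1)`, and the support is the closure of the point `π 0` or `∅`.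

## References

* [KudlaMillson1990] S. Kudla, J. Millson, *Intersection numbers of cycles on locally symmetric
  spaces and Fourier coefficients of holomorphic modular forms in several complex variables*,
  Publ. Math. IHÉS 71 (1990), §2 (special cycles `C_U = Γ_U \ D_U`, `D_U = {Z ∈ D : Z ⊆ U^⊥}`).
* [BergeronMillsonMoeglin2016Balls] N. Bergeron, J. Millson, C. Moeglin, *The Hodge conjecture and
  arithmetic quotients of complex balls*, Acta Math. 216 (2016) 1–125 = arXiv:1306.1515, Part 2
  §§3.1–3.3 (arXiv p. 35: `X_H`, `Z(U, g, K)`, connected cycles `c(U, g, K)`).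
* [AllcockFreitag2002] D. Allcock, E. Freitag, *Cubic surfaces and Borcherds products*, Comment.
  Math. Helv. 77 (2002), (2.1) (the Eisenstein lattice `𝓔^{1,4}`, form `ā₀b₀ - ā₁b₁ - ⋯ - ā₄b₄`).
* [AllcockCarlsonToledo2002] D. Allcock, J. Carlson, D. Toledo, *The complex hyperbolic geometry of
  the moduli space of cubic surfaces*, J. Algebraic Geom. 11 (2002) (root mirrors = sub-balls).
* [SGA1] A. Grothendieck, SGA 1, Exp. XII §2 (complex points and the Zariski topology).
-/

noncomputable section

open Matrix AlgebraicGeometry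

namespace Literature.AlgebraicGeometry.HodgeTheory

open Literature.AlgebraicGeometry.Motives (SchemeOver ComplexPoints AlgPoints IsSmoothProjective)

/-! ### The hermitian form `J = diag(1, -1, …, -1)` and the affine chart `z₀ = 1` of the ball -/

section BallChart

variable {n : ℕ}

/-- The Gram matrix `J = diag(1, -1, …, -1)` of the hermitian form of signature `(1, n)` on
`ℂ^{n+1}` for which the unit ball of the chart `z₀ = 1` is the set of positive lines
(Allcock–Freitag (2.1): `ā₀b₀ - ā₁b₁ - ⋯ - āₙbₙ`; the opposite of BMM's `V_{v₀}` of signature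
`(n, 1)`). [cite: AllcockFreitag2002, (2.1)] -/
def ballGram (n : ℕ) : Matrix (Fin (n + 1)) (Fin (n + 1)) ℂ :=
  Matrix.diagonal (Fin.cons 1 fun _ ↦ -1)

/-- The diagonal of `J`: `1` at `0`. [cite: AllcockFreitag2002, (2.1)] -/
@[simp]
theorem ballGram_diag_zero : (Fin.cons 1 (fun _ ↦ -1) : Fin (n + 1) → ℂ) 0 = 1 :=
  Fin.cons_zero _ _

/-- The diagonal of `J`: `-1` at positive indices. [cite: AllcockFreitag2002, (2.1)] -/
@[simp]
theorem ballGram_diag_succ (i : Fin n) : (Fin.cons 1 (fun _ ↦ -1) : Fin (n + 1) → ℂ) i.succ = -1 :=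
  Fin.cons_succ _ _ _

/-- For `n = 4`, `J` is the route's `Matrix.diagonal ![1, -1, -1, -1, -1]` (the Eisenstein lattice
`𝓔^{1,4}` of the moduli space of cubic surfaces). [cite: AllcockFreitag2002, (2.1)] -/
theorem ballGram_four : ballGram 4 = Matrix.diagonal ![(1 : ℂ), -1, -1, -1, -1] := by
  unfold ballGram
  congr 1
  ext i
  fin_cases i <;> rfl

/-- `J` is hermitian (real diagonal). [folklore] -/
theorem conjTranspose_ballGram : (ballGram n)ᴴ = ballGram n := by
  rw [ballGram, Matrix.diagonal_conjTranspose]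
  congr 1
  ext i
  refine Fin.cases ?_ (fun j ↦ ?_) i <;> simp

/-- `J² = 1`. [folklore] -/
theorem ballGram_mul_ballGram : ballGram n * ballGram n = 1 := by
  rw [ballGram, Matrix.diagonal_mul_diagonal, ← Matrix.diagonal_one]
  congr 1
  ext i
  refine Fin.cases ?_ (fun j ↦ ?_) i <;> simp

/-- The hermitian form `⟪u, v⟫_J = star u ⬝ᵥ (J *ᵥ v) = ū₀ v₀ - Σᵢ ūᵢ vᵢ` of signature `(1, n)`
(conjugate-linear in the first variable). [cite: AllcockFreitag2002, (2.1)] -/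
def ballForm (u v : Fin (n + 1) → ℂ) : ℂ :=
  star u ⬝ᵥ (ballGram n *ᵥ v)

/-- Unfolding of `ballForm`. [cite: AllcockFreitag2002, (2.1)] -/
theorem ballForm_def (u v : Fin (n + 1) → ℂ) : ballForm u v = star u ⬝ᵥ (ballGram n *ᵥ v) := rfl

/-- `⟪u, v⟫_J = ū₀ v₀ - Σᵢ ūᵢ₊₁ vᵢ₊₁` in coordinates. [cite: AllcockFreitag2002, (2.1)] -/
theorem ballForm_eq (u v : Fin (n + 1) → ℂ) :
    ballForm u v = star (u 0) * v 0 - ∑ i : Fin n, star (u i.succ) * v i.succ := by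
  simp only [ballForm, ballGram, dotProduct, Matrix.mulVec_diagonal, Pi.star_apply,
    Fin.sum_univ_succ, Fin.cons_zero, Fin.cons_succ, one_mul, neg_one_mul, mul_neg,
    Finset.sum_neg_distrib, sub_eq_add_neg]

/-- `⟪u, v⟫_J` is additive in the first variable. [folklore] -/
theorem ballForm_add_left (u u' v : Fin (n + 1) → ℂ) :
    ballForm (u + u') v = ballForm u v + ballForm u' v := by
  rw [ballForm, ballForm, ballForm, star_add, add_dotProduct]

/-- `⟪c • u, v⟫_J = c̄ ⟪u, v⟫_J` (conjugate-linear in the first variable). [folklore] -/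
theorem ballForm_smul_left (c : ℂ) (u v : Fin (n + 1) → ℂ) :
    ballForm (c • u) v = star c * ballForm u v := by
  rw [ballForm, ballForm, star_smul, smul_dotProduct, smul_eq_mul]

/-- `⟪u, c • v⟫_J = c ⟪u, v⟫_J` (linear in the second variable). [folklore] -/
theorem ballForm_smul_right (c : ℂ) (u v : Fin (n + 1) → ℂ) :
    ballForm u (c • v) = c * ballForm u v := by
  rw [ballForm, ballForm, mulVec_smul, dotProduct_smul, smul_eq_mul]

/-- `⟪0, v⟫_J = 0`. [folklore] -/
@[simp]
theorem ballForm_zero_left (v : Fin (n + 1) → ℂ) : ballForm 0 v = 0 := by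
  rw [ballForm, star_zero, zero_dotProduct]

/-- `⟪c • u, c • v⟫_J = |c|² ⟪u, v⟫_J`. [folklore] -/
theorem ballForm_smul_smul (c : ℂ) (u v : Fin (n + 1) → ℂ) :
    ballForm (c • u) (c • v) = (Complex.normSq c : ℂ) * ballForm u v := by
  rw [ballForm_smul_left, ballForm_smul_right, ← mul_assoc, Complex.star_def,
    ← Complex.normSq_eq_conj_mul_self]

/-- `⟪u, v + v'⟫_J = ⟪u, v⟫_J + ⟪u, v'⟫_J`. [folklore] -/
theorem ballForm_add_right (u v v' : Fin (n + 1) → ℂ) :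
    ballForm u (v + v') = ballForm u v + ballForm u v' := by
  rw [ballForm, ballForm, ballForm, mulVec_add, dotProduct_add]

/-- `⟪u - u', v⟫_J = ⟪u, v⟫_J - ⟪u', v⟫_J`. [folklore] -/
theorem ballForm_sub_left (u u' v : Fin (n + 1) → ℂ) :
    ballForm (u - u') v = ballForm u v - ballForm u' v := by
  rw [ballForm, ballForm, ballForm, star_sub, sub_dotProduct]

/-- `⟪u, v - v'⟫_J = ⟪u, v⟫_J - ⟪u, v'⟫_J`. [folklore] -/
theorem ballForm_sub_right (u v v' : Fin (n + 1) → ℂ) :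
    ballForm u (v - v') = ballForm u v - ballForm u v' := by
  rw [ballForm, ballForm, ballForm, mulVec_sub, dotProduct_sub]

/-- **Hermitian symmetry**: `⟪v, u⟫_J = conj ⟪u, v⟫_J` (`J` is real diagonal). [folklore] -/
theorem ballForm_conj_symm (u v : Fin (n + 1) → ℂ) : ballForm v u = star (ballForm u v) := by
  simp only [ballForm_eq, star_sub, star_sum, star_mul, star_star]

/-- **Unitary invariance**: a matrix `γ` with `γᴴ J γ = J` (the route's membership condition for the
deck group `S ⊆ U(J)`) preserves the form, `⟪γ u, γ v⟫_J = ⟪u, v⟫_J`. [folklore] -/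
theorem ballForm_mulVec_mulVec {γ : Matrix (Fin (n + 1)) (Fin (n + 1)) ℂ}
    (hγ : γᴴ * ballGram n * γ = ballGram n) (u v : Fin (n + 1) → ℂ) :
    ballForm (γ *ᵥ u) (γ *ᵥ v) = ballForm u v := by
  rw [ballForm, ballForm, star_mulVec, mulVec_mulVec, dotProduct_mulVec, vecMul_vecMul,
    ← Matrix.mul_assoc, hγ, ← dotProduct_mulVec]

/-- The homogeneous coordinates `ẑ = (1, z₁, …, zₙ) ∈ ℂ^{n+1}` of a point `z` of the affine chart
`z₀ = 1` (the chart in which the route writes the ball `{|z₁|² + ⋯ + |zₙ|² < 1}` and the deck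
relation `w = γ · z`). [cite: AllcockFreitag2002, (3.1)] -/
def ballLift (z : EuclideanSpace ℂ (Fin n)) : Fin (n + 1) → ℂ :=
  Fin.cons 1 (EuclideanSpace.equiv (Fin n) ℂ z)

/-- `ẑ₀ = 1`. [folklore] -/
@[simp]
theorem ballLift_zero (z : EuclideanSpace ℂ (Fin n)) : ballLift z 0 = 1 :=
  Fin.cons_zero _ _

/-- `ẑᵢ₊₁ = zᵢ`. [folklore] -/
@[simp]
theorem ballLift_succ (z : EuclideanSpace ℂ (Fin n)) (i : Fin n) : ballLift z i.succ = z i :=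
  Fin.cons_succ _ _ _

/-- `ẑ ≠ 0`. [folklore] -/
theorem ballLift_ne_zero (z : EuclideanSpace ℂ (Fin n)) : ballLift z ≠ 0 := fun h ↦ by
  have h0 := congr_fun h 0
  rw [ballLift_zero, Pi.zero_apply] at h0
  exact one_ne_zero h0

/-- `(γ ẑ)ᵢ = γᵢ₀ + Σⱼ γᵢ,ⱼ₊₁ zⱼ` — the linear forms appearing in the route's deck relation.
[cite: AllcockFreitag2002, (3.1)] -/
theorem mulVec_ballLift (γ : Matrix (Fin (n + 1)) (Fin (n + 1)) ℂ) (z : EuclideanSpace ℂ (Fin n))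
    (i : Fin (n + 1)) :
    (γ *ᵥ ballLift z) i = γ i 0 + ∑ j : Fin n, γ i j.succ * EuclideanSpace.equiv (Fin n) ℂ z j := by
  simp only [mulVec, dotProduct, Fin.sum_univ_succ, ballLift_zero, mul_one, ballLift_succ]
  rfl

/-- **The route's deck relation in vector form.** The coordinate relation
`wᵢ · (γ₀₀ + Σⱼ γ₀,ⱼ₊₁ zⱼ) = γᵢ₊₁,₀ + Σⱼ γᵢ₊₁,ⱼ₊₁ zⱼ` (all `i`), verbatim the clause of the items of
route `EisensteinMiddleThird`, says that `γ ẑ` is the multiple `(γ ẑ)₀ • ŵ` of `ŵ`, i.e. `w = γ · z`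
for the Möbius action in the chart `z₀ = 1`. [cite: AllcockFreitag2002, (3.1)] -/
theorem smul_ballLift_eq_mulVec_iff (γ : Matrix (Fin (n + 1)) (Fin (n + 1)) ℂ)
    (z w : EuclideanSpace ℂ (Fin n)) :
    (γ *ᵥ ballLift z) 0 • ballLift w = γ *ᵥ ballLift z ↔
      ∀ i : Fin n, EuclideanSpace.equiv (Fin n) ℂ w i *
          (γ 0 0 + ∑ j : Fin n, γ 0 j.succ * EuclideanSpace.equiv (Fin n) ℂ z j) =
        γ i.succ 0 + ∑ j : Fin n, γ i.succ j.succ * EuclideanSpace.equiv (Fin n) ℂ z j := by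
  constructor
  · intro h i
    have hi := congr_fun h i.succ
    rw [Pi.smul_apply, smul_eq_mul, ballLift_succ, mulVec_ballLift, mulVec_ballLift, mul_comm] at hi
    exact hi
  · intro h
    funext i
    refine Fin.cases ?_ (fun j ↦ ?_) i
    · rw [Pi.smul_apply, smul_eq_mul, ballLift_zero, mul_one]
    · rw [Pi.smul_apply, smul_eq_mul, ballLift_succ, mulVec_ballLift, mulVec_ballLift, mul_comm]
      exact h j

/-- **The ball is the set of positive lines**: `⟪ẑ, ẑ⟫_J = 1 - ‖z‖²` for the hermitian norm of
`EuclideanSpace ℂ (Fin n)`. [cite: AllcockFreitag2002, (3.1)] -/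
theorem ballForm_ballLift_self (z : EuclideanSpace ℂ (Fin n)) :
    ballForm (ballLift z) (ballLift z) = ((1 - ‖z‖ ^ 2 : ℝ) : ℂ) := by
  rw [ballForm_eq, EuclideanSpace.norm_sq_eq]
  push_cast
  congr 1
  · rw [ballLift_zero, star_one, one_mul]
  · refine Finset.sum_congr rfl fun i _ ↦ ?_
    rw [ballLift_succ, Complex.star_def, Complex.conj_mul']

/-- `re ⟪ẑ, ẑ⟫_J = 1 - ‖z‖²`. [cite: AllcockFreitag2002, (3.1)] -/
theorem re_ballForm_ballLift_self (z : EuclideanSpace ℂ (Fin n)) :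
    (ballForm (ballLift z) (ballLift z)).re = 1 - ‖z‖ ^ 2 := by
  rw [ballForm_ballLift_self, Complex.ofReal_re]

/-- `z` lies in the unit ball iff its homogeneous lift is a positive vector for `J`.
[cite: AllcockFreitag2002, (3.1)] -/
theorem mem_ball_iff_ballForm_pos (z : EuclideanSpace ℂ (Fin n)) :
    z ∈ Metric.ball (0 : EuclideanSpace ℂ (Fin n)) 1 ↔ 0 < (ballForm (ballLift z) (ballLift z)).re := by
  rw [re_ballForm_ballLift_self, mem_ball_zero_iff, sub_pos, sq_lt_one_iff₀ (norm_nonneg z)]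

/-- A vector `v` with `re ⟪v, v⟫_J > 0` has `v₀ ≠ 0` (`⟪v, v⟫_J = |v₀|² - Σ |vᵢ|²`). [folklore] -/
theorem apply_zero_ne_zero_of_ballForm_pos {v : Fin (n + 1) → ℂ} (hv : 0 < (ballForm v v).re) :
    v 0 ≠ 0 := by
  intro h0
  rw [ballForm_eq, h0, mul_zero, zero_sub, Complex.neg_re, Complex.re_sum] at hv
  have hnn : 0 ≤ ∑ i : Fin n, (star (v i.succ) * v i.succ).re :=
    Finset.sum_nonneg fun i _ ↦ by
      rw [Complex.star_def, Complex.conj_mul', ← Complex.ofReal_pow, Complex.ofReal_re]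
      positivity
  linarith

/-! ### The sub-ball `𝔹(W^⊥)` -/

/-- The vectors `J`-orthogonal on the left to `v`, `{w | ⟪w, v⟫_J = 0}`, as a complex subspace
(conjugate-linearity of `⟪·, v⟫_J`). [folklore] -/
def leftOrthogonal (v : Fin (n + 1) → ℂ) : Submodule ℂ (Fin (n + 1) → ℂ) where
  carrier := {w | ballForm w v = 0}
  zero_mem' := ballForm_zero_left v
  add_mem' {a b} ha hb := by
    simp only [Set.mem_setOf_eq] at ha hb ⊢
    rw [ballForm_add_left, ha, hb, add_zero]
  smul_mem' c {w} hw := by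
    simp only [Set.mem_setOf_eq] at hw ⊢
    rw [ballForm_smul_left, hw, mul_zero]

/-- Membership in `leftOrthogonal v`. [folklore] -/
@[simp]
theorem mem_leftOrthogonal_iff {v w : Fin (n + 1) → ℂ} : w ∈ leftOrthogonal v ↔ ballForm w v = 0 :=
  Iff.rfl

/-- **The sub-ball `𝔹(W^⊥)`** of the unit ball of `ℂⁿ` (chart `z₀ = 1`) cut out by a set of vectors
`W ⊆ ℂ^{n+1}`: the points `z` of the ball whose line `ℂ ẑ` is `J`-orthogonal to every `w ∈ W` —
Kudla–Millson's `D_W = {Z ∈ D : Z ⊆ W^⊥}`, BMM's `X_H` ("those [lines] which lie in `U^⊥`").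
Non-empty only when `W` spans a `J`-negative-definite subspace (then a totally geodesic sub-ball of
dimension `n - rank`). [cite: KudlaMillson1990, §2] [cite: BergeronMillsonMoeglin2016Balls, Part 2 §3.1] -/
def orthogonalSubBall (W : Set (Fin (n + 1) → ℂ)) : Set (EuclideanSpace ℂ (Fin n)) :=
  {z | z ∈ Metric.ball (0 : EuclideanSpace ℂ (Fin n)) 1 ∧ ∀ w ∈ W, ballForm w (ballLift z) = 0}

/-- Membership in `𝔹(W^⊥)`, abstract form. [cite: KudlaMillson1990, §2] -/
theorem mem_orthogonalSubBall_iff' {W : Set (Fin (n + 1) → ℂ)} {z : EuclideanSpace ℂ (Fin n)} :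
    z ∈ orthogonalSubBall W ↔
      z ∈ Metric.ball (0 : EuclideanSpace ℂ (Fin n)) 1 ∧ ∀ w ∈ W, ballForm w (ballLift z) = 0 :=
  Iff.rfl

/-- **`𝔹(W^⊥)` is an affine-linear slice of the ball**: `z ∈ 𝔹(W^⊥)` iff `‖z‖ < 1` and
`Σⱼ w̄ⱼ₊₁ zⱼ = w̄₀` for every `w ∈ W`. [cite: KudlaMillson1990, §2] -/
theorem mem_orthogonalSubBall_iff {W : Set (Fin (n + 1) → ℂ)} {z : EuclideanSpace ℂ (Fin n)} :
    z ∈ orthogonalSubBall W ↔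
      ‖z‖ < 1 ∧ ∀ w ∈ W, ∑ j : Fin n, star (w j.succ) * EuclideanSpace.equiv (Fin n) ℂ z j = star (w 0) := by
  rw [mem_orthogonalSubBall_iff', mem_ball_zero_iff]
  refine and_congr_right fun _ ↦ forall₂_congr fun w _ ↦ ?_
  rw [ballForm_eq, ballLift_zero, mul_one, sub_eq_zero, eq_comm]
  rfl

/-- `𝔹(W^⊥) ⊆ 𝔹ⁿ`. [cite: KudlaMillson1990, §2] -/
theorem orthogonalSubBall_subset_ball (W : Set (Fin (n + 1) → ℂ)) :
    orthogonalSubBall W ⊆ Metric.ball (0 : EuclideanSpace ℂ (Fin n)) 1 := fun _ hz ↦ hz.1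

/-- `𝔹(W^⊥)` is antitone in `W`. [cite: KudlaMillson1990, §2] -/
theorem orthogonalSubBall_anti {W W' : Set (Fin (n + 1) → ℂ)} (h : W ⊆ W') :
    orthogonalSubBall W' ⊆ orthogonalSubBall (n := n) W :=
  fun _ hz ↦ ⟨hz.1, fun w hw ↦ hz.2 w (h hw)⟩

/-- `𝔹(∅^⊥) = 𝔹ⁿ`. [cite: KudlaMillson1990, §2] -/
@[simp]
theorem orthogonalSubBall_empty :
    orthogonalSubBall (n := n) ∅ = Metric.ball (0 : EuclideanSpace ℂ (Fin n)) 1 :=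
  Set.ext fun _ ↦ ⟨fun hz ↦ hz.1, fun hz ↦ ⟨hz, fun _ hw ↦ hw.elim⟩⟩

/-- Adjoining `0` to `W` does not change `𝔹(W^⊥)`; in particular `𝔹({0}^⊥) = 𝔹ⁿ`.
[cite: KudlaMillson1990, §2] -/
@[simp]
theorem orthogonalSubBall_insert_zero (W : Set (Fin (n + 1) → ℂ)) :
    orthogonalSubBall (insert 0 W) = orthogonalSubBall (n := n) W := by
  refine Set.Subset.antisymm (orthogonalSubBall_anti (Set.subset_insert _ _)) fun z hz ↦ ⟨hz.1, ?_⟩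
  rintro w (rfl | hw)
  · exact ballForm_zero_left _
  · exact hz.2 w hw

/-- **Generators suffice**: `𝔹(W^⊥)` depends only on the complex span of `W` (so an `𝓔`-sublattice,
any `ℤ`-basis of it, and the `E`-subspace it spans cut out the same sub-ball).
[cite: KudlaMillson1990, §2] -/
theorem orthogonalSubBall_span (W : Set (Fin (n + 1) → ℂ)) :
    orthogonalSubBall (Submodule.span ℂ W : Set (Fin (n + 1) → ℂ)) = orthogonalSubBall (n := n) W := by
  refine Set.Subset.antisymm (orthogonalSubBall_anti Submodule.subset_span) fun z hz ↦ ⟨hz.1, ?_⟩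
  intro w hw
  exact (Submodule.span_le (p := leftOrthogonal (ballLift z))).2 hz.2 hw

/-- A set sandwiched between `W` and its span cuts out the same sub-ball as `W`.
[cite: KudlaMillson1990, §2] -/
theorem orthogonalSubBall_eq_of_subset_of_subset_span {W W' : Set (Fin (n + 1) → ℂ)} (h : W ⊆ W')
    (h' : W' ⊆ Submodule.span ℂ W) : orthogonalSubBall W' = orthogonalSubBall (n := n) W :=
  Set.Subset.antisymm (orthogonalSubBall_anti h)
    ((orthogonalSubBall_span W).symm.subset.trans (orthogonalSubBall_anti h'))

/-- **`𝔹(W^⊥) = ∅` unless `W` is `J`-negative**: if `W` contains a non-zero vector `w` with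
`re ⟪w, w⟫_J ≥ 0` (positive or isotropic), no point of the ball is orthogonal to it — `w^⊥` is then
negative semi-definite while `⟪ẑ, ẑ⟫_J = 1 - ‖z‖² > 0`. (Signature count: `J` has exactly one
positive direction.) [cite: KudlaMillson1990, §2] -/
theorem orthogonalSubBall_eq_empty_of_nonneg {W : Set (Fin (n + 1) → ℂ)} {w : Fin (n + 1) → ℂ}
    (hw : w ∈ W) (hw0 : w ≠ 0) (hnonneg : 0 ≤ (ballForm w w).re) :
    orthogonalSubBall (n := n) W = ∅ := by
  refine Set.eq_empty_iff_forall_notMem.2 fun z hz ↦ ?_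
  have hpos : 0 < (ballForm (ballLift z) (ballLift z)).re := (mem_ball_iff_ballForm_pos z).1 hz.1
  have horth : ballForm w (ballLift z) = 0 := hz.2 w hw
  have horth' : ballForm (ballLift z) w = 0 := by rw [ballForm_conj_symm, horth, star_zero]
  -- a vector with vanishing `0`-th coordinate is `J`-non-positive: `re ⟪u, u⟫ = -Σ |uᵢ|²`
  have key : ∀ u : Fin (n + 1) → ℂ, u 0 = 0 → (ballForm u u).re = -∑ i : Fin n, ‖u i.succ‖ ^ 2 := by
    intro u hu
    rw [ballForm_eq, hu, mul_zero, zero_sub, Complex.neg_re, Complex.re_sum]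
    congr 1
    refine Finset.sum_congr rfl fun i _ ↦ ?_
    rw [Complex.star_def, Complex.conj_mul', ← Complex.ofReal_pow, Complex.ofReal_re]
  -- project `w` to `ẑ^⊥ ∩ {u₀ = 0}`: `u = w - w₀ ẑ` has `u₀ = 0` and, by orthogonality,
  -- `⟪u, u⟫ = ⟪w, w⟫ + |w₀|² ⟪ẑ, ẑ⟫`
  have hexp : ballForm (w - w 0 • ballLift z) (w - w 0 • ballLift z) =
      ballForm w w + (Complex.normSq (w 0) : ℂ) * ballForm (ballLift z) (ballLift z) := by
    rw [ballForm_sub_left, ballForm_sub_right, ballForm_sub_right, ballForm_smul_right,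
      ballForm_smul_left, ballForm_smul_smul, horth, horth', mul_zero, mul_zero, sub_zero, zero_sub,
      sub_neg_eq_add]
  have hu0 : (w - w 0 • ballLift z) 0 = 0 := by
    rw [Pi.sub_apply, Pi.smul_apply, ballLift_zero, smul_eq_mul, mul_one, sub_self]
  have hle : (ballForm w w).re +
      Complex.normSq (w 0) * (ballForm (ballLift z) (ballLift z)).re ≤ 0 := by
    rw [← Complex.re_ofReal_mul, ← Complex.add_re, ← hexp, key _ hu0, neg_nonpos]
    positivity
  -- hence `w₀ = 0` …
  have hw00 : w 0 = 0 := by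
    by_contra hne
    have : 0 < Complex.normSq (w 0) * (ballForm (ballLift z) (ballLift z)).re :=
      mul_pos (Complex.normSq_pos.2 hne) hpos
    linarith
  -- … and then `0 ≤ re ⟪w, w⟫ = -Σ |wᵢ|²` forces `w = 0`
  have hsum : ∑ i : Fin n, ‖w i.succ‖ ^ 2 = 0 := by
    have h := key w hw00
    exact le_antisymm (by linarith) (by positivity)
  apply hw0
  funext i
  refine Fin.cases hw00 (fun j ↦ ?_) i
  have := (Finset.sum_eq_zero_iff_of_nonneg fun i _ ↦ by positivity).1 hsum j (Finset.mem_univ _)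
  exact norm_eq_zero.1 ((pow_eq_zero_iff two_ne_zero).1 this)

end BallChart

/-! ### The support of the special cycle attached to `W` -/

section Support

variable {n : ℕ} {X : SchemeOver ℂ}

/-- **The support of the special cycle of `W`** on a complex variety `X` whose analytification
`A : HodgeModel n X` is charted by the ball through `π : ℂⁿ ⊇ 𝔹ⁿ → X^an` (a `Γ'`-covering off a
closed `Z ⊆ X`, as in route `EisensteinMiddleThird`): the **Zariski closure in `X`** of the set of
points `(A.toComplexPoints (π z)).pt`, `z ∈ 𝔹(W^⊥)` — i.e. of the image of Kudla–Millson's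
`C_W = Γ'_W \ D_W → Γ' \ D` ("the natural map `Γ_{g,U} z ↦ Γ_g z` yield[s] a (totally geodesic)
immersion of `Γ_{g,U} \ X_H` into `Γ_g \ X`", the connected cycle `c(U, g, K)` of BMM Part 2 §3.3,
carrying the algebraic cycle `Z(U, g, K)` of §3.2). For `W` a `J`-definite `𝓔`-sublattice of rank
`k` of an arithmetic lattice this is an irreducible closed `(n - k)`-fold of `X` (Borel extension,
Baily–Borel, Chow) — NOT asserted by the definition, which is the bare closure; classes supported
on it are `classesSupportedOn X (specialCycleSupport A π W) (2 * k)`.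
[cite: KudlaMillson1990, §2] [cite: BergeronMillsonMoeglin2016Balls, Part 2 §§3.1–3.3] -/
def specialCycleSupport (A : HodgeModel n X) (π : EuclideanSpace ℂ (Fin n) → A.carrier)
    (W : Set (Fin (n + 1) → ℂ)) : Set X.left :=
  closure ((fun z ↦ (A.toComplexPoints (π z)).pt) '' orthogonalSubBall W)

variable (A : HodgeModel n X) (π : EuclideanSpace ℂ (Fin n) → A.carrier)

/-- Unfolding of `specialCycleSupport`: the Zariski closure of the image of `𝔹(W^⊥)`.
[cite: BergeronMillsonMoeglin2016Balls, Part 2 §3.3] -/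
theorem specialCycleSupport_def (W : Set (Fin (n + 1) → ℂ)) :
    specialCycleSupport A π W =
      closure ((fun z ↦ (A.toComplexPoints (π z)).pt) '' orthogonalSubBall W) :=
  rfl

/-- The support of a special cycle is Zariski closed. [cite: BergeronMillsonMoeglin2016Balls, Part 2 §3.2] -/
theorem isClosed_specialCycleSupport (W : Set (Fin (n + 1) → ℂ)) :
    IsClosed (specialCycleSupport A π W) :=
  isClosed_closure

/-- The images of the points of the sub-ball `𝔹(W^⊥)` lie on the support of the special cycle.
[cite: BergeronMillsonMoeglin2016Balls, Part 2 §3.3] -/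
theorem pt_mem_specialCycleSupport {W : Set (Fin (n + 1) → ℂ)} {z : EuclideanSpace ℂ (Fin n)}
    (hz : z ∈ orthogonalSubBall W) : (A.toComplexPoints (π z)).pt ∈ specialCycleSupport A π W :=
  subset_closure (Set.mem_image_of_mem _ hz)

/-- The image of `𝔹(W^⊥)` is contained in the support. [cite: BergeronMillsonMoeglin2016Balls, Part 2 §3.3] -/
theorem image_subset_specialCycleSupport (W : Set (Fin (n + 1) → ℂ)) :
    (fun z ↦ (A.toComplexPoints (π z)).pt) '' orthogonalSubBall W ⊆ specialCycleSupport A π W :=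
  subset_closure

/-- **Minimality**: the support is contained in every Zariski-closed subset of `X` containing the
images of the points of `𝔹(W^⊥)` (it is the smallest such). [cite: BergeronMillsonMoeglin2016Balls, Part 2 §3.2] -/
theorem specialCycleSupport_minimal {W : Set (Fin (n + 1) → ℂ)} {T : Set X.left} (hT : IsClosed T)
    (h : ∀ z ∈ orthogonalSubBall W, (A.toComplexPoints (π z)).pt ∈ T) :
    specialCycleSupport A π W ⊆ T :=
  closure_minimal (Set.image_subset_iff.2 fun z hz ↦ h z hz) hT

/-- **Antitonicity**: enlarging `W` shrinks the sub-ball and the support,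
`W ⊆ W' ⇒ specialCycleSupport A π W' ⊆ specialCycleSupport A π W` (`c(U') ⊆ c(U)` for `U ⊆ U'`).
[cite: BergeronMillsonMoeglin2016Balls, Part 2 §3.1] -/
theorem specialCycleSupport_anti {W W' : Set (Fin (n + 1) → ℂ)} (h : W ⊆ W') :
    specialCycleSupport A π W' ⊆ specialCycleSupport A π W :=
  closure_mono (Set.image_mono (orthogonalSubBall_anti h))

/-- The support depends only on the complex span of `W`. [cite: BergeronMillsonMoeglin2016Balls, Part 2 §3.1] -/
theorem specialCycleSupport_span (W : Set (Fin (n + 1) → ℂ)) :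
    specialCycleSupport A π (Submodule.span ℂ W : Set (Fin (n + 1) → ℂ)) = specialCycleSupport A π W := by
  rw [specialCycleSupport, orthogonalSubBall_span, specialCycleSupport]

/-- A set of generators sandwiched between `W` and its span has the same support as `W` (a
sublattice, a basis of it, the subspace it spans). [cite: BergeronMillsonMoeglin2016Balls, Part 2 §3.1] -/
theorem specialCycleSupport_eq_of_subset_of_subset_span {W W' : Set (Fin (n + 1) → ℂ)} (h : W ⊆ W')
    (h' : W' ⊆ Submodule.span ℂ W) : specialCycleSupport A π W' = specialCycleSupport A π W := by
  rw [specialCycleSupport, orthogonalSubBall_eq_of_subset_of_subset_span h h', specialCycleSupport]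

/-- Adjoining `0` does not change the support. [cite: BergeronMillsonMoeglin2016Balls, Part 2 §3.1] -/
@[simp]
theorem specialCycleSupport_insert_zero (W : Set (Fin (n + 1) → ℂ)) :
    specialCycleSupport A π (insert 0 W) = specialCycleSupport A π W := by
  rw [specialCycleSupport, orthogonalSubBall_insert_zero, specialCycleSupport]

/-- If `W` contains a non-zero `J`-non-negative vector the support is empty (no special cycle).
[cite: KudlaMillson1990, §2] -/
theorem specialCycleSupport_eq_empty_of_nonneg {W : Set (Fin (n + 1) → ℂ)} {w : Fin (n + 1) → ℂ}
    (hw : w ∈ W) (hw0 : w ≠ 0) (hnonneg : 0 ≤ (ballForm w w).re) :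
    specialCycleSupport A π W = ∅ := by
  rw [specialCycleSupport, orthogonalSubBall_eq_empty_of_nonneg hw hw0 hnonneg, Set.image_empty,
    closure_empty]

/-- **Classes supported on special cycles are antitone in `W`**:
`H_{c(W')} ≤ H_{c(W)}` for `W ⊆ W'` (`classesSupportedOn_mono`). [cite: BergeronMillsonMoeglin2016Balls, Part 2 §3.3] -/
theorem classesSupportedOn_specialCycleSupport_anti {W W' : Set (Fin (n + 1) → ℂ)} (h : W ⊆ W')
    (i : ℕ) :
    classesSupportedOn X (specialCycleSupport A π W') i ≤
      classesSupportedOn X (specialCycleSupport A π W) i :=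
  classesSupportedOn_mono (specialCycleSupport_anti A π h) i

/-- **Non-vacuity (`W = ∅`: the whole quotient).** If `π` maps the ball ONTO the points of `X^an`
lying off a proper Zariski-closed `Z ⊆ X` (the covering clause of route `EisensteinMiddleThird`),
`X` being irreducible and locally of finite type over `ℂ`, then the support attached to `W = ∅`
(sub-ball = the whole ball) is all of `X`: the closed points of `X` are exactly the `P.pt`,
`P ∈ X(ℂ)` (Nullstellensatz, the tree's `ComplexPoints.range_pt`), `X` is Jacobson, and the
non-empty open `X ∖ Z` is dense. [cite: SGA1, Exp. XII Prop. 2.1] -/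
theorem specialCycleSupport_empty_eq_univ [LocallyOfFiniteType X.hom] [IrreducibleSpace X.left]
    {Z : Set X.left} (hZ : IsClosed Z) (hZ' : Z ≠ Set.univ)
    (hπ : Set.SurjOn π (Metric.ball 0 1) {x | (A.toComplexPoints x).pt ∉ Z}) :
    specialCycleSupport A π ∅ = Set.univ := by
  haveI := Motives.ComplexPoints.jacobsonSpace_left (X := X)
  rw [specialCycleSupport, orthogonalSubBall_empty, Set.eq_univ_iff_forall]
  have hsub : Zᶜ ∩ closedPoints X.left ⊆
      (fun z ↦ (A.toComplexPoints (π z)).pt) '' Metric.ball (0 : EuclideanSpace ℂ (Fin n)) 1 := by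
    rintro x ⟨hxZ, hxc⟩
    obtain ⟨P, hP⟩ : x ∈ Set.range (AlgPoints.pt : ComplexPoints X → X.left) := by
      rw [Motives.ComplexPoints.range_pt]; exact hxc
    obtain ⟨a, rfl⟩ := A.isAnalytification.isHomeomorph.surjective P
    obtain ⟨z, hz, hza⟩ := hπ (show a ∈ {x | (A.toComplexPoints x).pt ∉ Z} by
      rw [Set.mem_setOf_eq, hP]; exact hxZ)
    exact ⟨z, hz, by simp only [hza, hP]⟩
  have hdense : Dense Zᶜ := hZ.isOpen_compl.dense (Set.nonempty_compl.2 hZ')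
  intro x
  have hx : x ∈ closure (Zᶜ ∩ closedPoints X.left) := by
    rw [JacobsonSpace.closure_inter_closedPoints_eq_closure hZ.isOpen_compl.isLocallyClosed,
      hdense.closure_eq]
    exact Set.mem_univ x
  exact closure_mono hsub hx

/-- Non-vacuity for the route's `X`: a smooth projective `n`-fold is irreducible and locally of
finite type, so under the covering clause the support attached to `W = ∅` is all of `X`.
[cite: SGA1, Exp. XII Prop. 2.1] -/
theorem specialCycleSupport_empty_eq_univ_of_isSmoothProjective (hX : IsSmoothProjective n X)
    {Z : Set X.left} (hZ : IsClosed Z) (hZ' : Z ≠ Set.univ)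
    (hπ : Set.SurjOn π (Metric.ball 0 1) {x | (A.toComplexPoints x).pt ∉ Z}) :
    specialCycleSupport A π ∅ = Set.univ := by
  haveI := hX.smoothOfRelativeDimension
  haveI : LocallyOfFiniteType X.hom := by
    haveI : Smooth X.hom := SmoothOfRelativeDimension.smooth n _
    infer_instance
  haveI : IrreducibleSpace X.left := by
    haveI := hX.geometricallyIrreducible
    exact GeometricallyIrreducible.irreducibleSpace_of_subsingleton X.hom
  exact specialCycleSupport_empty_eq_univ A π hZ hZ' hπ

/-- **`Γ`-invariance of special cycles.** Suppose the fibres of `π` on the ball are the orbits of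
a set `S` of `J`-unitary matrices acting by Möbius transformations in the chart `z₀ = 1` — the deck
clause `π z = π w ↔ ∃ γ ∈ S, w = γ · z` of route `EisensteinMiddleThird`, verbatim. Then for every
`γ ∈ S` the support attached to `W` is contained in the support attached to `γ W`: `γ` maps
`𝔹(W^⊥)` into `𝔹((γ W)^⊥)` (`⟪γ u, γ ẑ⟫_J = ⟪u, ẑ⟫_J`) and `π (γ · z) = π z`. (With `S` a group
one gets equality: the cycle `c(U)` depends only on the `Γ`-orbit of `U`.)
[cite: BergeronMillsonMoeglin2016Balls, Part 2 §3.3] [cite: KudlaMillson1990, §2] -/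
theorem specialCycleSupport_subset_of_deck {S : Set (Matrix (Fin (n + 1)) (Fin (n + 1)) ℂ)}
    (hS : ∀ γ ∈ S, γᴴ * ballGram n * γ = ballGram n)
    (hπ : ∀ z ∈ Metric.ball (0 : EuclideanSpace ℂ (Fin n)) 1,
      ∀ w ∈ Metric.ball (0 : EuclideanSpace ℂ (Fin n)) 1,
        π z = π w ↔ ∃ γ ∈ S, ∀ i : Fin n, EuclideanSpace.equiv (Fin n) ℂ w i *
            (γ 0 0 + ∑ j : Fin n, γ 0 j.succ * EuclideanSpace.equiv (Fin n) ℂ z j) =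
          γ i.succ 0 + ∑ j : Fin n, γ i.succ j.succ * EuclideanSpace.equiv (Fin n) ℂ z j)
    {γ : Matrix (Fin (n + 1)) (Fin (n + 1)) ℂ} (hγ : γ ∈ S) (W : Set (Fin (n + 1) → ℂ)) :
    specialCycleSupport A π W ⊆ specialCycleSupport A π (γ.mulVec '' W) := by
  refine closure_mono ?_
  rintro _ ⟨z, hz, rfl⟩
  have hγJ := hS γ hγ
  -- the image vector `γ ẑ` is `J`-positive, so its `0`-th coordinate is non-zero
  have hzpos : 0 < (ballForm (ballLift z) (ballLift z)).re := (mem_ball_iff_ballForm_pos z).1 hz.1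
  have hvpos : 0 < (ballForm (γ *ᵥ ballLift z) (γ *ᵥ ballLift z)).re := by
    rw [ballForm_mulVec_mulVec hγJ]; exact hzpos
  have hv0 : (γ *ᵥ ballLift z) 0 ≠ 0 := apply_zero_ne_zero_of_ballForm_pos hvpos
  -- the chart point `w = γ · z`, with `ŵ = (γ ẑ)₀⁻¹ • γ ẑ`
  obtain ⟨w, hlift⟩ : ∃ w : EuclideanSpace ℂ (Fin n),
      ballLift w = ((γ *ᵥ ballLift z) 0)⁻¹ • (γ *ᵥ ballLift z) := by
    refine ⟨(EuclideanSpace.equiv (Fin n) ℂ).symm fun i ↦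
      ((γ *ᵥ ballLift z) 0)⁻¹ * (γ *ᵥ ballLift z) i.succ, funext fun i ↦ ?_⟩
    refine Fin.cases ?_ (fun j ↦ ?_) i
    · rw [ballLift_zero, Pi.smul_apply, smul_eq_mul, inv_mul_cancel₀ hv0]
    · rw [Pi.smul_apply, smul_eq_mul, ballLift_succ]
      rfl
  have hwball : w ∈ Metric.ball (0 : EuclideanSpace ℂ (Fin n)) 1 := by
    rw [mem_ball_iff_ballForm_pos, hlift, ballForm_smul_smul, Complex.re_ofReal_mul,
      ballForm_mulVec_mulVec hγJ]
    exact mul_pos (Complex.normSq_pos.2 (inv_ne_zero hv0)) hzpos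
  have hdeck : (γ *ᵥ ballLift z) 0 • ballLift w = γ *ᵥ ballLift z := by
    rw [hlift, smul_smul, mul_inv_cancel₀ hv0, one_smul]
  -- `π` is constant on deck orbits …
  have hπzw : π z = π w :=
    (hπ z hz.1 w hwball).2 ⟨γ, hγ, (smul_ballLift_eq_mulVec_iff γ z w).1 hdeck⟩
  -- … and `w ∈ 𝔹((γ W)^⊥)` by unitary invariance of `⟪,⟫_J`
  refine ⟨w, ⟨hwball, ?_⟩, by simp only [hπzw]⟩
  rintro _ ⟨u, hu, rfl⟩
  rw [hlift, ballForm_smul_right, ballForm_mulVec_mulVec hγJ, hz.2 u hu, mul_zero]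

/-- The classes supported on the support of a special cycle vanish when `W` contains a non-zero
`J`-non-negative vector (the support is then empty, and nothing but `0` is supported on `∅`).
[cite: KudlaMillson1990, §2] -/
theorem classesSupportedOn_specialCycleSupport_eq_bot_of_nonneg {W : Set (Fin (n + 1) → ℂ)}
    {w : Fin (n + 1) → ℂ} (hw : w ∈ W) (hw0 : w ≠ 0) (hnonneg : 0 ≤ (ballForm w w).re) (i : ℕ) :
    classesSupportedOn X (specialCycleSupport A π W) i = ⊥ := by
  rw [specialCycleSupport_eq_empty_of_nonneg A π hw hw0 hnonneg, classesSupportedOn_empty]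

end Support

/-! ### The special span `SC^{2k} ⊗ ℂ` of a charted ball quotient -/

section Span

variable {n : ℕ} {X : SchemeOver ℂ} (A : HodgeModel n X) (π : EuclideanSpace ℂ (Fin n) → A.carrier)

/-- **The special span in degree `2k`** of the ball quotient charted by `(A, π)`, relative to a set
`L ⊆ ℂ^{n+1}` of lattice vectors (for route `EisensteinMiddleThird`: the Eisenstein-integral vectors
`𝓔^{n+1}`, `𝓔 = ℤ[ω]`): the complex subspace of `H²ᵏ(X(ℂ); ℂ)` spanned by the classes supported on
the special cycles `specialCycleSupport A π W`, `W ⊆ L` spanning a `k`-dimensional subspace —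
`⨆_W classesSupportedOn X (specialCycleSupport A π W) (2 * k)`. Only the `J`-negative-definite spans
contribute (`classesSupportedOn_specialCycleSupport_eq_bot_of_nonneg`: the others have empty
support), and those are the special cycles of codimension `k` (sub-ball quotients of dimension
`n - k`); this is the complexified definite-type part of Kudla–Millson's / BMM's `SC^{2k}(S)`
(BMM Part 2 §3.5, Theorem 67: "`SC^{2nq}(S) ⊆ H^{2nq}(S, ℚ)` … is defined over `ℚ`"), rendered, as
the tree's `ShimuraVarieties.specialCycleClasses` for compact quotients, without a cycle-class map.
[cite: BergeronMillsonMoeglin2016Balls, Part 2 §§3.3–3.5] [cite: KudlaMillson1990, §2] -/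
def specialCycleSpan (L : Set (Fin (n + 1) → ℂ)) (k : ℕ) : Submodule ℂ (complexBetti X (2 * k)) :=
  ⨆ (W : Set (Fin (n + 1) → ℂ)) (_ : W ⊆ L) (_ : Module.finrank ℂ (Submodule.span ℂ W) = k),
    classesSupportedOn X (specialCycleSupport A π W) (2 * k)

/-- Unfolding of `specialCycleSpan`. [cite: BergeronMillsonMoeglin2016Balls, Part 2 §3.5] -/
theorem specialCycleSpan_def (L : Set (Fin (n + 1) → ℂ)) (k : ℕ) :
    specialCycleSpan A π L k =
      ⨆ (W : Set (Fin (n + 1) → ℂ)) (_ : W ⊆ L) (_ : Module.finrank ℂ (Submodule.span ℂ W) = k),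
        classesSupportedOn X (specialCycleSupport A π W) (2 * k) :=
  rfl

/-- **Generators**: the classes supported on the special cycle of a `W ⊆ L` spanning a
`k`-dimensional subspace lie in the special span of degree `2k`.
[cite: BergeronMillsonMoeglin2016Balls, Part 2 §3.5] -/
theorem classesSupportedOn_le_specialCycleSpan {L W : Set (Fin (n + 1) → ℂ)} (hW : W ⊆ L) {k : ℕ}
    (hk : Module.finrank ℂ (Submodule.span ℂ W) = k) :
    classesSupportedOn X (specialCycleSupport A π W) (2 * k) ≤ specialCycleSpan A π L k :=
  le_iSup_of_le W (le_iSup_of_le hW (le_iSup_of_le hk le_rfl))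

/-- **Bounding the special span**: `SC^{2k} ≤ S` iff `S` contains the classes supported on every
special cycle of a `W ⊆ L` spanning a `k`-dimensional subspace.
[cite: BergeronMillsonMoeglin2016Balls, Part 2 §3.5] -/
theorem specialCycleSpan_le_iff {L : Set (Fin (n + 1) → ℂ)} {k : ℕ}
    {S : Submodule ℂ (complexBetti X (2 * k))} :
    specialCycleSpan A π L k ≤ S ↔ ∀ W : Set (Fin (n + 1) → ℂ), W ⊆ L →
      Module.finrank ℂ (Submodule.span ℂ W) = k →
        classesSupportedOn X (specialCycleSupport A π W) (2 * k) ≤ S := by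
  simp only [specialCycleSpan, iSup_le_iff]

/-- The special span is monotone in the set of lattice vectors. [cite: BergeronMillsonMoeglin2016Balls, Part 2 §3.5] -/
theorem specialCycleSpan_mono {L L' : Set (Fin (n + 1) → ℂ)} (h : L ⊆ L') (k : ℕ) :
    specialCycleSpan A π L k ≤ specialCycleSpan A π L' k :=
  (specialCycleSpan_le_iff A π).2 fun _ hW hk ↦
    classesSupportedOn_le_specialCycleSpan A π (hW.trans h) hk

/-- The special span consists of classes supported on Zariski-closed subsets of `X`: it is bounded
by any `S` containing `classesSupportedOn X T (2 * k)` for every closed `T` (e.g. by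
`supportedClasses X (2 * k) 0`). For the bound by `Nᵏ H²ᵏ = algebraicClasses X k` one needs the
codimension of the special cycles, which is not part of the definition.
[cite: BergeronMillsonMoeglin2016Balls, Part 2 §3.2] -/
theorem specialCycleSpan_le_of_forall_isClosed {L : Set (Fin (n + 1) → ℂ)} {k : ℕ}
    {S : Submodule ℂ (complexBetti X (2 * k))}
    (hS : ∀ T : Set X.left, IsClosed T → classesSupportedOn X T (2 * k) ≤ S) :
    specialCycleSpan A π L k ≤ S :=
  (specialCycleSpan_le_iff A π).2 fun W _ _ ↦ hS _ (isClosed_specialCycleSupport A π W)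

end Span

end Literature.AlgebraicGeometry.HodgeTheory

end
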